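import Mathlib
import Summits.PneNP.PneNP.Theorems.ClusUniversalCertificateCoordDefs
import Summits.PneNP.PneNP.Theorems.ClusUniversalCertificateCoordBaseOnes
import Summits.PneNP.PneNP.Theorems.ClusUniversalCertificateOPlusDefs
import Summits.PneNP.PneNP.Theorems.ClusUniversalCertificateOPlusImpliesUC

/-!
# Route ClusUniversalCertificate — (⊕) line: converse bookkeeping and the unit-block rung (crux `UniversalCertAll`, stmt-PneNP-19683)

Rung F-N1, cell pnp-ideate.  ADAPTED FROM pnp-ideate-lit g10's `HOME/pnp-ideate-lit/landing-oplus/ClusUniversalCertificateOPlusSupport.lean`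
§7 (lit cannot propose `Summits/`; its §§1–6 = `qpotDom`/`oplusImpliesUC` are the tree's `ClusUniversalCertificateOPlusImpliesUC`,
proved independently by this seat; §7 is re-based here on `ClusCoordOPlus.ucMix_iff_dsum_le_bpot`, credit lit g10):

* `isDomPot_bpot_of_ucMix`, `ucMixDim_iff_isDomPot` — `UCMixDim M ↔` every block potential on `𝔽₂^M` dominates `dsum`
  (the form p1's birth certificate for the re-cut route quotes);
* `isDomPot_bpot_of_bsize_le_one` — all blocks of size `≤ 1`: the m = 1 theorem (`ClusCoord.stub_baseOnes`);
* `bsize_id`, `bpot_id_apply` — unit blocks: `bpot id z = 2·#{j : z j = 0}`;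
* **`oplus_unitPotentials : ∀ a b, IsDomPot (a+b) (dplus (bpot id) (bpot id))`** — a PROVED instance of the conjecture (⊕):
  the direct sum of the two UC₁ potentials is the UC₁ potential of `𝔽₂^{a+b}` (`Fin.sum_univ_add`), dominating by m = 1.

HONEST FRAMING: bookkeeping and one rung; (⊕) (`OPlusAll`) is OPEN; FRONTIER rung F-N1 — nothing here bears on P vs NP.
-/

set_option linter.dupNamespace false -- `Summit.PneNP.PneNP.…`: summit = sub-problem name (D-0017 single-conjunct layout)

namespace Summit.PneNP.PneNP.Theorems.ClusCoordOPlus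

open Finset Summit.PneNP.PneNP.Theorems.ClusCoord

/-! ## Converse bookkeeping and the unit-block rung (adapted from pnp-ideate-lit g10's OPlusSupport.lean §7) -/

section Extras

variable {M n : ℕ}

/-- Converse bookkeeping: if the mixed certificate holds for every `Y`, the block potential dominates
(immediate from `ucMix_iff_dsum_le_bpot`). [lit g10 §7, adapted] -/
theorem isDomPot_bpot_of_ucMix (blk : Fin M → Fin n) (h : ∀ Y, UCMix M n blk Y) :
    IsDomPot M (bpot blk) := fun Y => (ucMix_iff_dsum_le_bpot blk Y).1 (h Y)

/-- `UCMixDim M` is exactly: every block potential on `𝔽₂^M` dominates `dsum`. [lit g10 §7, adapted] -/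
theorem ucMixDim_iff_isDomPot (M : ℕ) :
    UCMixDim M ↔ ∀ (n : ℕ) (blk : Fin M → Fin n), IsDomPot M (bpot blk) :=
  ⟨fun h n blk => isDomPot_bpot_of_ucMix blk (h n blk),
    fun h n blk Y => (ucMix_iff_dsum_le_bpot blk Y).2 (h n blk Y)⟩

/-- The unit-block case (every block of size `≤ 1`) is the m = 1 theorem, landed as `ClusCoord.stub_baseOnes`.
[lit g10 §7, adapted] -/
theorem isDomPot_bpot_of_bsize_le_one (blk : Fin M → Fin n) (hb : ∀ j, bsize blk j ≤ 1) :
    IsDomPot M (bpot blk) :=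
  isDomPot_bpot_of_ucMix blk fun Y => Summit.PneNP.PneNP.Theorems.ClusCoord.stub_baseOnes M n blk Y hb

/-- Unit blocks have size `1`. [lit g10 §7] -/
theorem bsize_id (M : ℕ) (j : Fin M) : bsize (id : Fin M → Fin M) j = 1 := by
  unfold bsize
  rw [Finset.card_eq_one]
  exact ⟨j, by ext i; simp⟩

/-- The UC₁ potential `2·#{zero coordinates}` is the block potential of the unit blocks. [lit g10 §7] -/
theorem bpot_id_apply (M : ℕ) (z : Fin M → ZMod 2) :
    bpot (id : Fin M → Fin M) z = ∑ j : Fin M, (if z j = 0 then (2 : ℚ) else 0) := by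
  unfold bpot
  refine Finset.sum_congr rfl fun j _ => ?_
  rw [bsize_id]
  have hiff : (∀ i : Fin M, (id i : Fin M) = j → z i = 0) ↔ z j = 0 :=
    ⟨fun h => h j rfl, fun h i hi => by simp only [id] at hi; rw [hi]; exact h⟩
  by_cases hz : z j = 0
  · rw [if_pos (hiff.mpr hz), if_pos hz]; norm_num
  · rw [if_neg (fun h => hz (hiff.mp h)), if_neg hz]; norm_num

/-- **RUNG** (a PROVED instance of the conjecture (⊕)): the direct sum of the two unit-block (UC₁) potentials of
`𝔽₂^a` and `𝔽₂^b` dominates `dsum` on `𝔽₂^{a+b}` — it is the unit-block potential of `𝔽₂^{a+b}`, dominating by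
the m = 1 theorem. [lit g10 §7] -/
theorem oplus_unitPotentials (a b : ℕ) :
    IsDomPot (a + b) (dplus (bpot (id : Fin a → Fin a)) (bpot (id : Fin b → Fin b))) := by
  intro S
  have h := isDomPot_bpot_of_bsize_le_one (id : Fin (a + b) → Fin (a + b)) (fun j => by rw [bsize_id]) S
  calc ((dsum (a + b) S : ℤ) : ℚ) ≤ ∑ x ∈ S, bpot (id : Fin (a + b) → Fin (a + b)) x := h
    _ = ∑ x ∈ S, dplus (bpot (id : Fin a → Fin a)) (bpot (id : Fin b → Fin b)) x := by
      refine Finset.sum_congr rfl fun x _ => ?_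
      unfold dplus
      rw [bpot_id_apply, bpot_id_apply, bpot_id_apply, Fin.sum_univ_add]

end Extras

end Summit.PneNP.PneNP.Theorems.ClusCoordOPlus
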